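import Literature.Computability.AlgebraicComplexity.PowerSumProductObstructionsProofs
import Literature.Barriers.ValiantsHypothesis.NotViaSaturationsAlonTarsiDrisko
import HarnessLib

/-!
# Ikenmeyer–Kandasamy's Prop. 5.3, second bullet, "in particular" clause: for `m = τ ± 1`
# (`τ` an odd prime) `ν` occurs in `ℂ[\overline{GL_m · x_1⋯x_m}]`

Topic `Literature/Computability/AlgebraicComplexity` (the toy pair power sum versus product of
variables, `PowerSumProductObstructions.lean`). This file DISCHARGES the named fact
`IK2020_prop_5_3_2_primes`:

* C. Ikenmeyer, U. Kandasamy, *Implementing geometric complexity theory: On the separation of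
  orbit closures via symmetries*, STOC 2020 = arXiv:1911.03990, Prop. 5.3, second bullet (e-print
  p. 10), AS PRINTED: "If `m` satisfies the Alon-Tarsi condition, then
  `mult_{ν^*} ℂ[\overline{Gq}] > 0` and hence `ν` is not an occurrence obstruction. In particular
  this is true for `m = τ ± 1` for all odd primes `τ`." (with `ν = (2m) + (m × 2m)`, `q = x_1⋯x_m`,
  `m ≥ 4` even, as in Thm. 4.3; IK §5, p. 10: "This is proved for all `m = τ+1` [Dri:97] for an
  odd prime number `τ` and for all `m = τ-1` [Gly:10]").

as `theorem IK2020_prop_5_3_2_primes_holds : IK2020_prop_5_3_2_primes`, by assembling three tree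
theorems exactly along the printed sentence: the reduction of the clause to the Alon–Tarsi
theorems of Drisko (`m = τ + 1`) and Glynn (`m = τ - 1`)
(`IK2020_prop_5_3_2_primes_of_alonTarsi`, `PowerSumProductObstructionsProofs.lean`: Kumar's
occurrences of `(m)` and `(m × m)` in `ℂ[Chow_m]` under Alon–Tarsi and the semigroup property),
Drisko 1997 Thm. 9 (`Drisko1997_AlonTarsi_holds`, `NotViaSaturationsAlonTarsiDrisko.lean`) and
Glynn 2010 Thm. 3.2 (`Glynn2010_AlonTarsi_holds`, `NotViaSaturationsAlonTarsiProofs.lean`).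
Honest framing of the cell served (`pub-gct-max`, track T): a kernel discharge of one cited,
printed statement about the toy model; nothing here is a claim on VP vs VNP or P vs NP.

## References

* C. Ikenmeyer, U. Kandasamy, Proc. 52nd ACM STOC (2020) 713–726 = arXiv:1911.03990, Prop. 5.3
  and §5 p. 10. [IkenmeyerKandasamy2019]
* A. A. Drisko, Adv. Math. 128 (1997) 20–35, Thm. 9. [Drisko1997]
* D. G. Glynn, SIAM J. Discrete Math. 24 (2010) 394–399, Thm. 3.2. [Glynn2010AlonTarsi]
-/

namespace Literature.Computability.AlgebraicComplexity

open _root_.Literature.Barriers.ValiantsHypothesis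

/-- **DISCHARGE of `IK2020_prop_5_3_2_primes`** (Ikenmeyer–Kandasamy 2020, Prop. 5.3, second
bullet, "In particular this is true for `m = τ ± 1` for all odd primes `τ`"): for `m ≥ 4`, `τ` an
odd prime and `m = τ + 1` or `m = τ - 1`, `0 < mult_{ν^*} ℂ[\overline{GL_m · x_1⋯x_m}]`,
`ν = (2m) + (m × 2m)`. Proof = the printed sentence: Drisko 1997 Thm. 9 / Glynn 2010 Thm. 3.2
give the Alon–Tarsi condition for `m`, and the second bullet (Kumar + semigroup,
`IK2020_prop_5_3_2_holds`) gives the occurrence.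
[cite: IkenmeyerKandasamy2019, Prop. 5.3] [cite: Drisko1997, Thm. 9] [cite: Glynn2010AlonTarsi, Thm. 3.2] -/
theorem IK2020_prop_5_3_2_primes_holds : IK2020_prop_5_3_2_primes :=
  IK2020_prop_5_3_2_primes_of_alonTarsi Drisko1997_AlonTarsi_holds Glynn2010_AlonTarsi_holds

end Literature.Computability.AlgebraicComplexity
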